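import Mathlib
import Literature.NumberTheory.Transcendental.LinEDS
import Literature.NumberTheory.Transcendental.LinEDSCode
import HarnessLib

/-!
# `KernelModuloPeriodConjecture`, line `Sketch`, E6: soundness of the packed `𝔽₂` elimination

Crux `FurushoPentagon.KernelModuloPeriodConjecture` (stmt-KontsevichZagierPeriods-15058), line
`Sketch`; soundness chain of the kernel-checkable `𝔽₂` rank engine `LinEDS` for the linearised
extended double shuffle system [IharaKanekoZagier2006, §2], link E6 ("soundness of the packed
GF(2) elimination", `stub_elimLoop_sound`): if the rows fit in their slots (`r < 2^W`), a
successful run of `LinEDS.elimLoop W (rep W n) cs (pack W rows)` produces, for every column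
`c ∈ cs`, an XOR-combination of the rows (`LinEDS.XorGen rows`) that is a pivot at `c`
(`LinEDS.isPivotAt`: bit `c`, nothing below).

Proof. (1) Slot calculus for `slot W M i = (M >>> iW) % 2^W`: the slots of `a ^^^ b`, of
`M >>> W`, of `2^W X + Y` (`Y < 2^W`). (2) No-carry product: if `sel` has bits only at multiples
of `W` and `p < 2^W`, slot `i` of `sel * p` is `p` or `0` according to bit `iW` of `sel`
(induction on `i`, peeling the bottom slot of `sel`). (3) Packing: bit `m` of `packLoop f w l` is
bit `m % w` of block `m / w` of `l` when the blocks are `< 2^w` and `|l| ≤ 2^f` (induction on the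
fuel through one `packPass`, which merges adjacent blocks); hence slot `i` of `pack W rows` is
`rows[i]` (or `0`), and `rep W n = pack W [1, …, 1]` has bits only at multiples of `W`. (4) The
invariant "every slot is an XOR-combination of the rows" is preserved by one column step of
`elimLoop` (`M ↦ (M ^^^ sel * p) >>> W`, `p` the bottom slot, `sel = (M >>> c) &&& rep W n`), and
success on `c :: cs` says that the bottom slot is a pivot at `c`. The hypothesis `c < W` of the
registered statement is not needed. Everything here is elementary. [folklore]
-/

namespace Summit.KontsevichZagierPeriods.FurushoPentagon.KernelModuloPeriodConjecture

open Literature.NumberTheory.Transcendental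

/-! ### XOR-combinations -/

/-- `XorGen rows` is closed under `^^^`. [folklore] -/
theorem elimE6_xorGen_xor {rows : List ℕ} {a b : ℕ} (ha : LinEDS.XorGen rows a)
    (hb : LinEDS.XorGen rows b) : LinEDS.XorGen rows (a ^^^ b) := by
  induction hb with
  | zero => rwa [Nat.xor_zero]
  | xor _ hr ih => rw [← Nat.xor_assoc]; exact LinEDS.XorGen.xor ih hr

/-- Every row is an XOR-combination of the rows. [folklore] -/
theorem elimE6_xorGen_of_mem {rows : List ℕ} {r : ℕ} (hr : r ∈ rows) : LinEDS.XorGen rows r := by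
  rw [← Nat.zero_xor r]
  exact LinEDS.XorGen.xor LinEDS.XorGen.zero hr

/-- `rows[i]` (or `0` past the end) is an XOR-combination of the rows. [folklore] -/
theorem elimE6_xorGen_getD (rows : List ℕ) (i : ℕ) : LinEDS.XorGen rows (rows.getD i 0) := by
  rw [List.getD_eq_getElem?_getD]
  cases h : rows[i]? with
  | none => exact LinEDS.XorGen.zero
  | some r => exact elimE6_xorGen_of_mem (List.mem_of_getElem? h)

/-- `rows[i]` (or `0` past the end) is below `2^W` if every row is. [folklore] -/
theorem elimE6_getD_lt {rows : List ℕ} {W : ℕ} (h : ∀ r ∈ rows, r < 2 ^ W) (i : ℕ) :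
    rows.getD i 0 < 2 ^ W := by
  rw [List.getD_eq_getElem?_getD]
  cases h' : rows[i]? with
  | none => exact Nat.two_pow_pos W
  | some r => exact h r (List.mem_of_getElem? h')

/-! ### Slot calculus -/

/-- Bits of a slot: bit `t < W` of slot `i` is bit `iW + t` of the matrix. [folklore] -/
theorem elimE6_slot_testBit (W M i t : ℕ) :
    (LinEDS.slot W M i).testBit t = (decide (t < W) && M.testBit (i * W + t)) := by
  simp [LinEDS.slot]

/-- Slot `0` is the residue mod `2^W`. [folklore] -/
theorem elimE6_slot_zero (W M : ℕ) : LinEDS.slot W M 0 = M % 2 ^ W := by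
  simp [LinEDS.slot]

/-- Slots of an XOR. [folklore] -/
theorem elimE6_slot_xor (W a b i : ℕ) :
    LinEDS.slot W (a ^^^ b) i = LinEDS.slot W a i ^^^ LinEDS.slot W b i := by
  simp only [LinEDS.slot, Nat.shiftRight_xor_distrib, Nat.xor_mod_two_pow]

/-- Dropping the bottom slot shifts the slots down by one. [folklore] -/
theorem elimE6_slot_shiftRight (W M i : ℕ) :
    LinEDS.slot W (M >>> W) i = LinEDS.slot W M (i + 1) := by
  simp only [LinEDS.slot, ← Nat.shiftRight_add, Nat.succ_mul, Nat.add_comm]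

/-- Slots of `2^W X + Y` with `Y < 2^W`: slot `0` is `Y`, slot `i + 1` is slot `i` of `X`.
[folklore] -/
theorem elimE6_slot_two_pow_mul_add {W Y : ℕ} (X : ℕ) (hY : Y < 2 ^ W) (i : ℕ) :
    LinEDS.slot W (2 ^ W * X + Y) 0 = Y ∧
      LinEDS.slot W (2 ^ W * X + Y) (i + 1) = LinEDS.slot W X i := by
  constructor
  · rw [elimE6_slot_zero, Nat.mul_add_mod, Nat.mod_eq_of_lt hY]
  · simp only [LinEDS.slot, Nat.shiftRight_eq_div_pow, Nat.succ_mul, Nat.pow_add]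
    rw [Nat.mul_comm (2 ^ (i * W)), ← Nat.div_div_eq_div_mul, Nat.mul_add_div (Nat.two_pow_pos W),
      Nat.div_eq_of_lt hY, Nat.add_zero]

/-- **No-carry product.** If `sel` has bits only at multiples of `W` (`0 < W`) and `p < 2^W`,
slot `i` of `sel * p` is `p` or `0` according to bit `iW` of `sel`. [folklore] -/
theorem elimE6_slot_mul {W p : ℕ} (hW : 0 < W) (hp : p < 2 ^ W) :
    ∀ (i sel : ℕ), (∀ m, sel.testBit m = true → W ∣ m) →
      LinEDS.slot W (sel * p) i = if sel.testBit (i * W) then p else 0 := by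
  -- the bottom slot of such a `sel` is its bit `0`
  have hlow : ∀ sel : ℕ, (∀ m, sel.testBit m = true → W ∣ m) →
      sel % 2 ^ W = if sel.testBit 0 then 1 else 0 := fun sel hsel => by
    apply Nat.eq_of_testBit_eq
    intro t
    rw [Nat.testBit_mod_two_pow]
    cases t with
    | zero => cases sel.testBit 0 <;> simp [hW]
    | succ t =>
      have hr : (if sel.testBit 0 then 1 else 0 : ℕ).testBit (t + 1) = false := by
        split
        · exact Nat.testBit_eq_false_of_lt (Nat.one_lt_two_pow (Nat.succ_ne_zero t))
        · exact Nat.zero_testBit _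
      rw [hr]
      cases ht : sel.testBit (t + 1) with
      | false => simp
      | true =>
        have := Nat.le_of_dvd (Nat.succ_pos t) (hsel _ ht)
        simpa using this
  -- `sel * p = 2^W (⌊sel / 2^W⌋ p) + (bottom bit) p`, the last term `< 2^W`
  have hdec : ∀ sel : ℕ, (∀ m, sel.testBit m = true → W ∣ m) →
      sel * p = 2 ^ W * (sel / 2 ^ W * p) + (if sel.testBit 0 then p else 0) ∧
        (if sel.testBit 0 then p else 0) < 2 ^ W := fun sel hsel => by
    constructor
    · conv_lhs => rw [← Nat.div_add_mod sel (2 ^ W), hlow sel hsel]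
      rw [Nat.add_mul, Nat.mul_assoc]
      cases sel.testBit 0 <;> simp
    · split
      · exact hp
      · exact Nat.two_pow_pos W
  -- the bits of `⌊sel / 2^W⌋` are again at multiples of `W`
  have hdiv : ∀ sel : ℕ, (∀ m, sel.testBit m = true → W ∣ m) →
      ∀ m, (sel / 2 ^ W).testBit m = true → W ∣ m := fun sel hsel m hm => by
    rw [Nat.testBit_div_two_pow] at hm
    exact (Nat.dvd_add_left (dvd_refl W)).1 (hsel _ hm)
  intro i
  induction i with
  | zero =>
    intro sel hsel
    obtain ⟨h1, h2⟩ := hdec sel hsel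
    rw [h1, (elimE6_slot_two_pow_mul_add _ h2 0).1, Nat.zero_mul]
  | succ i ih =>
    intro sel hsel
    obtain ⟨h1, h2⟩ := hdec sel hsel
    rw [h1, (elimE6_slot_two_pow_mul_add _ h2 i).2, ih _ (hdiv sel hsel), Nat.testBit_div_two_pow,
      Nat.succ_mul]

/-! ### Packing -/

/-- One packing pass halves the number of blocks. [folklore] -/
theorem elimE6_packPass_length (w : ℕ) :
    ∀ l : List ℕ, (LinEDS.packPass w l).length = (l.length + 1) / 2
  | [] => rfl
  | [a] => by simp [show LinEDS.packPass w [a] = [a] from rfl]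
  | a :: b :: l => by
    rw [show LinEDS.packPass w (a :: b :: l) = (a ||| (b <<< w)) :: LinEDS.packPass w l from rfl,
      List.length_cons, elimE6_packPass_length w l, List.length_cons, List.length_cons]
    omega

/-- One packing pass doubles the block width. [folklore] -/
theorem elimE6_packPass_lt (w : ℕ) : ∀ l : List ℕ, (∀ x ∈ l, x < 2 ^ w) →
    ∀ y ∈ LinEDS.packPass w l, y < 2 ^ (2 * w)
  | [], _ => by simp [LinEDS.packPass]
  | [a], h => by
    intro y hy
    have hy' : y = a := by simpa [LinEDS.packPass] using hy
    subst hy'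
    exact lt_of_lt_of_le (h y (by simp)) (Nat.pow_le_pow_right two_pos (by omega))
  | a :: b :: l, h => by
    intro y hy
    rw [show LinEDS.packPass w (a :: b :: l) = (a ||| (b <<< w)) :: LinEDS.packPass w l from rfl,
      List.mem_cons] at hy
    rcases hy with rfl | hy
    · have h2 : 2 ^ (2 * w) = 2 ^ w * 2 ^ w := by rw [two_mul, Nat.pow_add]
      apply Nat.or_lt_two_pow
      · exact lt_of_lt_of_le (h a (by simp)) (Nat.pow_le_pow_right two_pos (by omega))
      · rw [Nat.shiftLeft_eq, h2]
        exact Nat.mul_lt_mul_of_lt_of_le (h b (by simp)) le_rfl (Nat.two_pow_pos w)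
    · exact elimE6_packPass_lt w l (fun x hx => h x (by simp [hx])) y hy

/-- A single block: bit `m` of `a < 2^w` is bit `m % w` of block `m / w` of `[a]`. [folklore] -/
theorem elimE6_single_testBit {w a : ℕ} (hw : 0 < w) (ha : a < 2 ^ w) (m : ℕ) :
    a.testBit m = ([a].getD (m / w) 0).testBit (m % w) := by
  by_cases hm : m < w
  · rw [Nat.div_eq_of_lt hm, Nat.mod_eq_of_lt hm, List.getD_cons_zero]
  · obtain ⟨k, hk⟩ : ∃ k, m / w = k + 1 :=
      ⟨m / w - 1, by have := Nat.div_pos (not_lt.1 hm) hw; omega⟩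
    rw [hk, List.getD_cons_succ, List.getD_nil, Nat.zero_testBit]
    exact Nat.testBit_eq_false_of_lt
      (lt_of_lt_of_le ha (Nat.pow_le_pow_right two_pos (not_lt.1 hm)))

/-- Bits of the blocks after one packing pass: block `j` of `packPass w l` is
`l[2j] + 2^w l[2j+1]`. [folklore] -/
theorem elimE6_packPass_testBit {w : ℕ} (hw : 0 < w) : ∀ l : List ℕ, (∀ x ∈ l, x < 2 ^ w) →
    ∀ j m : ℕ, m < 2 * w →
      ((LinEDS.packPass w l).getD j 0).testBit m = (l.getD (2 * j + m / w) 0).testBit (m % w)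
  | [], _, j, m, _ => by simp [LinEDS.packPass]
  | [a], h, 0, m, _ => by
    rw [show LinEDS.packPass w [a] = [a] from rfl, List.getD_cons_zero, Nat.mul_zero, Nat.zero_add]
    exact elimE6_single_testBit hw (h a (by simp)) m
  | [a], h, j + 1, m, _ => by
    rw [show LinEDS.packPass w [a] = [a] from rfl, List.getD_cons_succ, List.getD_nil,
      show 2 * (j + 1) + m / w = (2 * j + m / w + 1) + 1 by ring, List.getD_cons_succ,
      List.getD_nil, Nat.zero_testBit, Nat.zero_testBit]
  | a :: b :: l, h, 0, m, hm => by
    rw [show LinEDS.packPass w (a :: b :: l) = (a ||| (b <<< w)) :: LinEDS.packPass w l from rfl,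
      List.getD_cons_zero, Nat.testBit_or, Nat.testBit_shiftLeft, Nat.mul_zero, Nat.zero_add]
    by_cases hmw : m < w
    · rw [Nat.div_eq_of_lt hmw, Nat.mod_eq_of_lt hmw, List.getD_cons_zero]
      simp [Nat.not_le.2 hmw]
    · have hle : w ≤ m := not_lt.1 hmw
      have hdiv : m / w = 1 :=
        Nat.div_eq_of_lt_le (by rwa [Nat.one_mul]) (by rwa [show (1 + 1) * w = 2 * w by ring])
      have hmod : m % w = m - w := by
        rw [Nat.mod_eq_sub_mod hle, Nat.mod_eq_of_lt (by omega)]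
      rw [hdiv, hmod, List.getD_cons_succ, List.getD_cons_zero,
        Nat.testBit_eq_false_of_lt
          (lt_of_lt_of_le (h a (by simp)) (Nat.pow_le_pow_right two_pos hle))]
      simp [hle]
  | a :: b :: l, h, j + 1, m, hm => by
    rw [show LinEDS.packPass w (a :: b :: l) = (a ||| (b <<< w)) :: LinEDS.packPass w l from rfl,
      List.getD_cons_succ, elimE6_packPass_testBit hw l (fun x hx => h x (by simp [hx])) j m hm,
      show 2 * (j + 1) + m / w = (2 * j + m / w + 1) + 1 by ring, List.getD_cons_succ,
      List.getD_cons_succ]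

/-- **Bits of the packed matrix.** With blocks `< 2^w` (`0 < w`) and enough fuel (`|l| ≤ 2^f`),
bit `m` of `packLoop f w l` is bit `m % w` of block `m / w` of `l`. [folklore] -/
theorem elimE6_packLoop_testBit : ∀ (f w : ℕ) (l : List ℕ), 0 < w → (∀ x ∈ l, x < 2 ^ w) →
    l.length ≤ 2 ^ f → ∀ m, (LinEDS.packLoop f w l).testBit m = (l.getD (m / w) 0).testBit (m % w)
  | 0, w, [], _, _, _, m => by simp [LinEDS.packLoop]
  | 0, w, [a], hw, h, _, m => by
    rw [show LinEDS.packLoop 0 w [a] = a from rfl]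
    exact elimE6_single_testBit hw (h a (by simp)) m
  | 0, w, a :: b :: l, _, _, hlen, m => by
    exfalso
    simp only [List.length_cons, Nat.pow_zero] at hlen
    omega
  | f + 1, w, [], _, _, _, m => by simp [LinEDS.packLoop]
  | f + 1, w, [a], hw, h, _, m => by
    rw [show LinEDS.packLoop (f + 1) w [a] = a from rfl]
    exact elimE6_single_testBit hw (h a (by simp)) m
  | f + 1, w, a :: b :: l, hw, h, hlen, m => by
    have hlen' : (LinEDS.packPass w (a :: b :: l)).length ≤ 2 ^ f := by
      have h1 := elimE6_packPass_length w (a :: b :: l)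
      have h2 : 2 ^ (f + 1) = 2 * 2 ^ f := by rw [Nat.pow_succ, Nat.mul_comm]
      simp only [List.length_cons] at h1 hlen
      omega
    rw [show LinEDS.packLoop (f + 1) w (a :: b :: l) =
        LinEDS.packLoop f (2 * w) (LinEDS.packPass w (a :: b :: l)) from rfl,
      elimE6_packLoop_testBit f (2 * w) _ (by omega) (elimE6_packPass_lt w _ h) hlen' m,
      elimE6_packPass_testBit hw _ h _ _ (Nat.mod_lt m (by omega)), Nat.mod_mul_left_mod]
    congr 2
    rw [Nat.mod_mul_left_div_self, Nat.mul_comm 2 w, ← Nat.div_div_eq_div_mul]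
    exact Nat.div_add_mod (m / w) 2

/-- **Bits of `pack`**: bit `m` of `pack W rows` is bit `m % W` of `rows[m / W]` (or `0`).
[folklore] -/
theorem elimE6_pack_testBit {W : ℕ} (hW : 0 < W) {rows : List ℕ} (h : ∀ r ∈ rows, r < 2 ^ W)
    (m : ℕ) : (LinEDS.pack W rows).testBit m = (rows.getD (m / W) 0).testBit (m % W) := by
  rw [LinEDS.pack, LinEDS.lengthTR_eq_length]
  exact elimE6_packLoop_testBit _ _ _ hW h Nat.lt_two_pow_self.le m

/-- **Slots of `pack`** are the rows: slot `i` of `pack W rows` is `rows[i]` (or `0`). [folklore] -/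
theorem elimE6_slot_pack {W : ℕ} (hW : 0 < W) {rows : List ℕ} (h : ∀ r ∈ rows, r < 2 ^ W)
    (i : ℕ) : LinEDS.slot W (LinEDS.pack W rows) i = rows.getD i 0 := by
  apply Nat.eq_of_testBit_eq
  intro t
  rw [elimE6_slot_testBit]
  by_cases ht : t < W
  · rw [decide_eq_true ht, Bool.true_and, elimE6_pack_testBit hW h, Nat.mul_comm,
      Nat.mul_add_div hW, Nat.div_eq_of_lt ht, Nat.add_zero, Nat.mul_add_mod, Nat.mod_eq_of_lt ht]
  · rw [decide_eq_false ht, Bool.false_and]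
    exact (Nat.testBit_eq_false_of_lt (lt_of_lt_of_le (elimE6_getD_lt h i)
      (Nat.pow_le_pow_right two_pos (not_lt.1 ht)))).symm

/-- `rep W n` has bits only at the slot bases (multiples of `W`). [folklore] -/
theorem elimE6_rep_dvd {W : ℕ} (hW : 0 < W) (n : ℕ) {m : ℕ}
    (hm : (LinEDS.rep W n).testBit m = true) : W ∣ m := by
  have h1 : ∀ r ∈ List.replicate n 1, r < 2 ^ W := fun r hr => by
    rw [List.eq_of_mem_replicate hr]
    exact Nat.one_lt_two_pow hW.ne'
  rw [LinEDS.rep, elimE6_pack_testBit hW h1] at hm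
  have h2 : (List.replicate n 1).getD (m / W) 0 ≤ 1 := by
    rw [List.getD_eq_getElem?_getD, List.getElem?_replicate]
    split <;> simp
  by_contra hdvd
  have h3 : m % W ≠ 0 := fun h0 => hdvd (Nat.dvd_of_mod_eq_zero h0)
  rw [Nat.testBit_eq_false_of_lt (lt_of_le_of_lt h2 (Nat.one_lt_two_pow h3))] at hm
  exact Bool.false_ne_true hm

/-! ### The invariant of the elimination -/

/-- **The invariant of the elimination.** If `R` has bits only at slot bases and every slot of
`M` is an XOR-combination of the rows, a successful `elimLoop W R cs M` yields, for every column of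
`cs`, a pivot that is an XOR-combination of the rows: one step replaces slot `i + 1` by
`slot (i+1) ^^^ (p or 0)` (`p` the bottom slot) and drops slot `0`. [folklore] -/
theorem elimE6_loop {W R : ℕ} (rows : List ℕ) (hW : 0 < W) (hR : ∀ m, R.testBit m = true → W ∣ m) :
    ∀ (cs : List ℕ) (M : ℕ), (∀ i, LinEDS.XorGen rows (LinEDS.slot W M i)) →
      LinEDS.elimLoop W R cs M = true →
        ∀ c ∈ cs, ∃ p, LinEDS.XorGen rows p ∧ LinEDS.isPivotAt p c = true
  | [], _, _, _ => by simp
  | c :: cs, M, hM, h => by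
    have h' : (LinEDS.isPivotAt (M % 2 ^ W) c &&
        LinEDS.elimLoop W R cs ((M ^^^ (((M >>> c) &&& R) * (M % 2 ^ W))) >>> W)) = true := h
    rw [Bool.and_eq_true] at h'
    have hp : LinEDS.XorGen rows (M % 2 ^ W) := elimE6_slot_zero W M ▸ hM 0
    intro c' hc'
    rcases List.mem_cons.1 hc' with rfl | hc'
    · exact ⟨M % 2 ^ W, hp, h'.1⟩
    · refine elimE6_loop rows hW hR cs _ (fun i => ?_) h'.2 c' hc'
      rw [elimE6_slot_shiftRight, elimE6_slot_xor,
        elimE6_slot_mul hW (Nat.mod_lt M (Nat.two_pow_pos W)) (i + 1) _ fun m hm =>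
          hR m (by rw [Nat.testBit_and, Bool.and_eq_true] at hm; exact hm.2)]
      refine elimE6_xorGen_xor (hM (i + 1)) ?_
      split
      · exact hp
      · exact LinEDS.XorGen.zero

/-- **E6 — soundness of the packed elimination.** If the rows fit in the slots (`r < 2^W`) and the
columns are below `W`, a successful `elimLoop` yields, for every column `c`, an XOR-combination of
the rows that is a pivot at `c` (bit `c`, nothing below). [folklore] -/
theorem stub_elimLoop_sound :
    ∀ (W : ℕ) (rows cs : List ℕ), 0 < W → (∀ r ∈ rows, r < 2 ^ W) → (∀ c ∈ cs, c < W) →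
      LinEDS.elimLoop W (LinEDS.rep W rows.length) cs (LinEDS.pack W rows) = true →
        ∀ c ∈ cs, ∃ p, LinEDS.XorGen rows p ∧ LinEDS.isPivotAt p c = true :=
  fun W rows cs hW hrows _ h =>
    elimE6_loop rows hW (fun _ hm => elimE6_rep_dvd hW rows.length hm) cs _
      (fun i => by rw [elimE6_slot_pack hW hrows]; exact elimE6_xorGen_getD rows i) h

end Summit.KontsevichZagierPeriods.FurushoPentagon.KernelModuloPeriodConjecture
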